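import Summits.QuantumFields.YangMills.Theorems.BalabanUVNodesN15AtRRec13CoPH
import Summits.QuantumFields.YangMills.Theorems.BalabanUVNodesN15TwoGridReadout

/-!
# Route «BalabanUVNodes», cluster K4 «SpineRates» — node N15 = NE2: THE NON-DEGENERACY GUARD FOR THE PAIRED-INSTANCE FAMILY `ne2` AT THE ₁₃ KEYS
# (plan g77 (q2) for N15; W-SEAT-START-LIST v2∕v3 §2 n15 ITEM 2), its junk doors in kernel, what it makes the node's clauses say, and which tree families pass

Cell `pub-ymgap`, WIDTH SEAT `pub-ymgap-dag-n15-w2` (director-ym №197 ∕ HUMAN RULING D-0149), generation 0.  Filed `--kind proof --supports stmt-QuantumFields-20544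
--as helper` (K3⁷ `SpineGivenEndpointR13SepCoPH`) — COUNT-NEUTRAL.  Definition lane: ONE `structure … : Prop` (the guard) + ONE `def … : Prop` (its keyed form);
every theorem is kernel bookkeeping over tree declarations BY NAME; nothing landed is edited or re-declared.

WHY.  Plan g77 [YMPLAN-G77-K3STUB1-DECISION] (pub-ymgap INBOX l.23415) ∕ [K3V2-DRAFT-TYPED] (l.23852): the K3⁷ v2 skeleton keys the six rates on THE BUNDLE OF RECORD
`rateCarriersOfRecord₁₃CoPH 𝔯 F θ hP g₀ os (ksel …)` (`Thm/BalabanUVNodesRateCarriersOfRecord13CoPH` :130), whose N15 component is `ne2OfRecord₁₁ ((𝔯.lit F θ hP g₀ os).ne2 k)`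
with `𝔯.lit` RESIDUAL inside `∃ 𝔯`; ask (q2) to the N15 lanes = «the record NAME of the paired-instance family `ne2`, or the non-degeneracy guard, so v2 pins `rr.ne2`».
FIRST-HAND ANSWER (tree `rg`, 2026-08-27): there is NO paired-instance family OF RECORD by name — NODE 00's [B9] operator layer of Bałaban's run is not constructed;
`ne2` is a PARAMETER everywhere (`RateReading₁₃CoPH.lit`, `readingOfRecord₁₃CoPH w1 ℓ₃ ne2 ne1`); the -a lane's realised families (`NE2NodeTorus.knitInstance`, the
`TwoGrid.tgInstance`-based `fullG…Objects` ∕ `c2…Objects`) are `U ≡ 1` ∕ MODEL inhabitants.  So v2 guards `rr.ne2` where `∃ 𝔯` stands, and «nonempty paired family»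
(RR-1 §8 `NE2Objects₁₁.Populated`) ALONE is cosmetic against a junk one notch smarter than dag-n18-e's evidence #5 (`keyedRates_junk`: the EMPTY family):
(J2) every family whose [B9] size parameter `gf.M` is BOUNDED carries `NE2PlusOperator ∧ NE2PlusSite` FOR ARBITRARY KERNELS — the shapes open with
«`∃ M₅ > 0, ∀ i, M₅ ≤ (pi i).gf.M → …`» (`T4EtaRate` :250 ∕ :257), take `M₅ := sup gf.M + 1` (dag-ref-B READ-323 ∕ READ-335 ∕ READ-686-ERRATUM, INBOX l.11794: the
`unitTorusGeo … M := 1` families are «bounded-M class», probe `pub-ymgap-dag-ref-B/READS/probe-ne2-vec-full-vacuity.lean`); (J3) ZERO KERNELS carry all three layers on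
every sign-sane family (the majorants are `≥ 0`).  THIS FILE TYPES THE GUARD that closes (J1) = empty family and (J2), shows what the node's clauses then SAY about the
pinned kernels, and records honestly that (J3) is the door NO carrier guard closes (that tie is the pin BY NAME of the kernels to Bałaban's propagators — NODE 00's
object; cf. `Node00/RateRecord11` §8 «populatedness is NECESSARY for a contentful knit, never sufficient»).

WHAT THIS MODULE DECLARES ∕ PROVES.
* §1 `Live c` (`c : NE2Carriers`) — (G1–G3) COFINAL: for every size threshold `M₅` and every scale count `k₀` some instance has `M₅ ≤ gf.M` AND `k₀ ≤ gc.k` (the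
  «for `M ≥ M₅`» clause of [B9] Thms 3.1∕3.2 is LIVE and the factor `θ^k` is a RATE, not one constant — the tree's own convention `T4EtaRateSiteTorus.TorusIndex.M`
  v1.2 «ALL cube sizes `M ≥ 1` … so that the guard `M₅ ≤ M` reads»); (G4) the trivial configuration is (3.35)∧(3.36)-regular at every `α₀ > 0` on every instance
  (`T4EtaRate.ne2Zero_of_ne2Plus`'s `hreg`); (G5) the unit-lattice region `inΛ i` is met.  Faces: `live_iff`, `Live.nonempty` (⇒ G1), `Live.mLive`, `Live.kLive`,
  `Live.populated_of_ne2OfRecord₁₁` (⇒ RR-1's display); the KEYED form `KeyedLive rr` at the guarded admissible Stage-13 tuples (binder shape = the v2 draft's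
  `KeyedRatesHolderD4`), `keyedLive_rateCarriersOfRecord₁₃CoPH_iff` (at the bundle of record it reads `Live (ne2OfRecord₁₁ ((𝔯.lit …).ne2 (ksel …)))`).
* §2 JUNK DOORS (kernel): (J1) `n15At_and_not_live_of_isEmpty` (empty family: `N15At` by `N15AtSpineCarriers.n15At_of_isEmpty`, cited, and `¬ Live`); (J2)
  `ne2PlusOperator_of_gf_M_lt` ∕ `ne2PlusSite_of_gf_M_lt` (bounded `gf.M` ⇒ operator AND site layers for ANY kernels, ANY `c35`, `p`) and `not_live_of_gf_M_lt`;
  instance `tgInstance_gf_M` (`= 1`, `rfl`) ⇒ `ne2PlusOperator_tgInstance_comp` ∕ `ne2PlusSite_tgInstance_comp` (every family `tgInstance d hL ∘ f`, arbitrary kernels)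
  and `not_live_tgInstance_comp`; (J3) `n15At_of_kernels_zero` (honesty: passes every carrier guard); KEYED: `not_keyedLive_of_isEmpty` ∕ `not_keyedLive_of_gf_M_lt`
  (R3's negative controls, under the existence of ONE guarded admissible tuple = K0⁷'s content) and `keyedLive_of_no_tuple` (located vacuity without it).
* §3 WHAT THE GUARD MAKES `N15At` SAY: `etaRateIneq342_one_cofinal_of_live` ∕ `etaRateIneqSite_one_cofinal_of_live` ∕ `etaRateIneqUnit_one_cofinal_of_live` — uniform
  constants and, for EVERY threshold `(M₅, k₀)`, an instance beyond it at which the (3.42)- ∕ (3.48)- ∕ (3.187)-shape η-rate inequality holds for `c`'s OWN kernels at the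
  trivial configuration (a genuine rate statement about the pinned kernels); `ne2ZeroOperator_of_live` (NE2⁰ by `ne2Zero_of_ne2Plus`).
* §4 TREE FAMILIES: `live_knitCarriers` — the -a lane's g0 LG-vector knit family on `KnitIndex 3 L` (cube size `i.M ≥ 1` FREE, scale count free, one-point regular
  backgrounds, `inAll`) PASSES; `live_and_n15At_knitCarriers` — with `N15Knit.N15_with_zero_layers_dim4` it is an A6 inhabitant of «guard ∧ `N15At`» (hypothesis-free,
  `L ≥ 2`, `μ ≠ ν`); `exists_reading_keyedLive_n15At` — SOME Stage-13 reading passes `KeyedLive` at the bundle of record AND carries `N15At` there (so a v2 stub 1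
  conjoined with `KeyedLive` is satisfiable at the N15 slot, R3's positive control); the `tgInstance`-based families are (J2)'s instance AS TYPED TODAY (LOCATED = ref-B's
  standing finding in guard form; NOT a defect of the -a lane's estimates, whose proofs take `M₅ := 1` and bound every index — the repair «realise `M := min_μ M_μ → ∞`
  or state the per-index `EtaRateIneq342`» is the lane owner's call).

HONEST FRAMING.  Helper lane, count-neutral kernel bookkeeping; a GUARD EXCLUDES CARRIER JUNK, it does not tie `ne2`'s kernels to Bałaban's propagators and asserts
no estimate; nothing of Bałaban's is asserted or instantiated; NE2⁺ is NOT PRINTED for d = 4 ([Balaban1985BackgroundPropagators] Thms 3.1∕3.2∕3.15 print uniformity in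
η, never a difference; [King1986] Lemma 4.5 (4.38) p.674 is the A = 0 scalar template) and NOT PROVED; N15 NOT discharged; K3⁷ OPEN, not claimed; counts UNMOVED (typed
28∕28 · discharged 5∕27, A 5∕28); the Yang–Mills mass gap (Clay) is NOT proved by any of this — R4 closes the conditional finite-𝕋⁴ rung `BalabanLadder.UV` only; nothing
continuum ∕ ℝ⁴ ∕ OS.  No `sorry`, no `instance`, no `notation`; restate-immune (no Theses import).
-/

set_option autoImplicit false

noncomputable section

namespace Summit.QuantumFields.YangMills.BalabanUVNodes.N15.PairedFamilyGuard

open Literature.MathematicalPhysics.QuantumFieldTheory.Balaban1983to89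
open Literature.MathematicalPhysics.QuantumFieldTheory.Balaban1983to89.T4Continuum (T4Family ULoop)
open Literature.MathematicalPhysics.QuantumFieldTheory.Balaban1983to89.T4EtaRate (PairedInstance NE2PlusOperator NE2PlusSite NE2PlusUnit NE2ZeroOperator
  EtaRateIneq342 EtaRateIneqSite EtaRateIneqUnit rateFactor rateFactor_nonneg ne2Zero_of_ne2Plus)
open Literature.MathematicalPhysics.QuantumFieldTheory.Balaban1983to89.NE2NodeTorus (KnitIndex knitInstance knitOp166 knitSite163 covOpKernels inAll rhoDist)
open Node00 (Stage13HParams NE2Objects₁₁ RateObjects₁₁ nonempty_rateObjects₁₁)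
open Summit.QuantumFields.YangMills.Theorems.N15AtSpineCarriers (n15At_of_isEmpty)
open Summit.QuantumFields.YangMills.Theorems.BalabanUVNodesN15Knit (N15_with_zero_layers_dim4)
open Summit.QuantumFields.YangMills.BalabanUVNodes.N15.TwoGrid (TGIndex tgInstance)
open YMDAG.UVSplit (NE1pCarriers NE2Carriers RateCarriers N15At ne2OfRecord₁₁ RateReading₁₃CoPH rateCarriersOfRecord₁₃CoPH)

/-! ## §1 The guard and its faces -/

/-- **THE NON-DEGENERACY GUARD FOR N15's PAIRED-INSTANCE FAMILY** (`c : NE2Carriers`, the K4 currency `R.ne2`).  (G1–G3) `cofinal`: for every [B9] size threshold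
`M₅` and every scale count `k₀` SOME paired instance has `M₅ ≤ gf.M` and `k₀ ≤ gc.k` — so the «for `M ≥ M₅`» clause of `NE2PlusOperator` ∕ `NE2PlusSite` cannot be
voided by a large `M₅` (junk door (J2)) and the factor `θ^k` of `NE2PlusUnit` is a RATE over unboundedly many scales; (G4) `reg_one`: the trivial configuration of every
instance is (3.35)- and (3.36)-regular at every `α₀ > 0` (the «for all regular `U`» clauses bite at least at `U ≡ 1`); (G5) `inΛ_nonempty`: the unit-lattice region is met
(the `EtaRateIneqUnit` clause bites).  A guard on CARRIERS: it excludes the empty ∕ bounded-`M` ∕ bounded-`k` ∕ nowhere-regular ∕ empty-region families; it does NOT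
tie the kernels to Bałaban's propagators (door (J3)). [folklore] -/
@[folklore]
structure Live (c : NE2Carriers) : Prop where
  /-- (G1–G3) size threshold and scale count jointly cofinal over the family -/
  cofinal : ∀ (M₅ : ℝ) (k₀ : ℕ), ∃ i : c.I, M₅ ≤ (c.pi i).gf.M ∧ k₀ ≤ (c.pi i).gc.k
  /-- (G4) the trivial configuration is (3.35)∧(3.36)-regular at every `α₀ > 0`, on every instance -/
  reg_one : ∀ (i : c.I) (α₀ : ℝ), 0 < α₀ → (c.pi i).Bf.Reg335 c.c35 α₀ (c.pi i).Bf.one ∧ (c.pi i).Bf.Reg336 c.c35 α₀ (c.pi i).Bf.one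
  /-- (G5) the unit-lattice region of every instance is met -/
  inΛ_nonempty : ∀ i : c.I, ∃ y : (c.pi i).gc.Site, c.inΛ i y

/-- The guard unfolded. [bookkeeping] -/
theorem live_iff (c : NE2Carriers) :
    Live c ↔ (∀ (M₅ : ℝ) (k₀ : ℕ), ∃ i : c.I, M₅ ≤ (c.pi i).gf.M ∧ k₀ ≤ (c.pi i).gc.k) ∧
      (∀ (i : c.I) (α₀ : ℝ), 0 < α₀ → (c.pi i).Bf.Reg335 c.c35 α₀ (c.pi i).Bf.one ∧ (c.pi i).Bf.Reg336 c.c35 α₀ (c.pi i).Bf.one) ∧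
      (∀ i : c.I, ∃ y : (c.pi i).gc.Site, c.inΛ i y) :=
  ⟨fun h => ⟨h.cofinal, h.reg_one, h.inΛ_nonempty⟩, fun h => ⟨h.1, h.2.1, h.2.2⟩⟩

/-- (G1) A live family HAS paired instances. [bookkeeping] -/
theorem Live.nonempty {c : NE2Carriers} (h : Live c) : Nonempty c.I :=
  let ⟨i, _⟩ := h.cofinal 0 0
  ⟨i⟩

/-- (G2) A live family has UNBOUNDED [B9] size parameter `gf.M`. [bookkeeping] -/
theorem Live.mLive {c : NE2Carriers} (h : Live c) (M₅ : ℝ) : ∃ i : c.I, M₅ ≤ (c.pi i).gf.M :=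
  let ⟨i, hi, _⟩ := h.cofinal M₅ 0
  ⟨i, hi⟩

/-- (G3) A live family has UNBOUNDED scale count `gc.k`. [bookkeeping] -/
theorem Live.kLive {c : NE2Carriers} (h : Live c) (k₀ : ℕ) : ∃ i : c.I, k₀ ≤ (c.pi i).gc.k :=
  let ⟨i, _, hi⟩ := h.cofinal 0 k₀
  ⟨i, hi⟩

/-- **THE GUARD IMPLIES RR-1's DISPLAY**: NE2 objects whose carriers of record are live are `Populated` (`Node00.NE2Objects₁₁.Populated := Nonempty I`). [bookkeeping] -/
theorem Live.populated_of_ne2OfRecord₁₁ {o : NE2Objects₁₁} (h : Live (ne2OfRecord₁₁ o)) : o.Populated :=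
  (NE2Objects₁₁.populated_iff o).2 h.nonempty

section Keyed

variable {N : ℕ} [NeZero N]

/-- **THE KEYED GUARD** for a tuple-level rate reading `rr` (the v2 draft's `rr` ∕ `rrOfRecord 𝔯 ksel`; binder shape = `KeyedRatesHolderD4`): at every admissible
Stage-13 tuple with core provisos under the guard of record `ZhUnity ∧ SlotsNondegenerate₁₃`, for every `(g₀, os)`, the reading's N15 carriers are live. [folklore] -/
@[folklore]
def KeyedLive (rr : (F : T4Family) → (θ : Stage13HParams F N) → θ.Provisos₁₃CoPH F N → (ℕ → ℝ) → List (ULoop F) → RateCarriers N) : Prop :=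
  ∀ (F : T4Family) (θ : Stage13HParams F N) (hP : θ.Provisos₁₃CoPH F N), (θ.ZhUnity F N ∧ θ.SlotsNondegenerate₁₃ F N) → θ.Admissible F N →
    ∀ (g₀ : ℕ → ℝ) (os : List (ULoop F)), Live (rr F θ hP g₀ os).ne2

/-- **AT THE BUNDLE OF RECORD** the keyed guard reads on the reading's level-selected NE2 OBJECTS: `Live (ne2OfRecord₁₁ ((𝔯.lit F θ hP g₀ os).ne2 (ksel …)))`
(`Iff.rfl`; `rateCarriersOfRecord₁₃CoPH`'s second component). [bookkeeping] -/
theorem keyedLive_rateCarriersOfRecord₁₃CoPH_iff (𝔯 : RateReading₁₃CoPH N)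
    (ksel : (F : T4Family) → (θ : Stage13HParams F N) → θ.Provisos₁₃CoPH F N → (ℕ → ℝ) → List (ULoop F) → ℕ) :
    KeyedLive (fun F θ hP g₀ os => rateCarriersOfRecord₁₃CoPH 𝔯 F θ hP g₀ os (ksel F θ hP g₀ os)) ↔
      ∀ (F : T4Family) (θ : Stage13HParams F N) (hP : θ.Provisos₁₃CoPH F N), (θ.ZhUnity F N ∧ θ.SlotsNondegenerate₁₃ F N) → θ.Admissible F N →
        ∀ (g₀ : ℕ → ℝ) (os : List (ULoop F)), Live (ne2OfRecord₁₁ ((𝔯.lit F θ hP g₀ os).ne2 (ksel F θ hP g₀ os))) :=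
  Iff.rfl

/-- … hence a keyed-live reading of record is `Populated` at every selected level (RR-1's display, keyed). [bookkeeping] -/
theorem populated_of_keyedLive_rateCarriersOfRecord₁₃CoPH (𝔯 : RateReading₁₃CoPH N)
    (ksel : (F : T4Family) → (θ : Stage13HParams F N) → θ.Provisos₁₃CoPH F N → (ℕ → ℝ) → List (ULoop F) → ℕ)
    (h : KeyedLive (fun F θ hP g₀ os => rateCarriersOfRecord₁₃CoPH 𝔯 F θ hP g₀ os (ksel F θ hP g₀ os)))
    (F : T4Family) (θ : Stage13HParams F N) (hP : θ.Provisos₁₃CoPH F N) (hU : θ.ZhUnity F N ∧ θ.SlotsNondegenerate₁₃ F N) (hθ : θ.Admissible F N)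
    (g₀ : ℕ → ℝ) (os : List (ULoop F)) : ((𝔯.lit F θ hP g₀ os).ne2 (ksel F θ hP g₀ os)).Populated :=
  Live.populated_of_ne2OfRecord₁₁ (h F θ hP hU hθ g₀ os)

end Keyed

/-! ## §2 The junk doors in kernel: (J1) empty family, (J2) bounded size parameter, (J3) zero kernels -/

/-- **(J1) THE EMPTY FAMILY carries `N15At` (tree: `N15AtSpineCarriers.n15At_of_isEmpty`) and FAILS the guard.** [bookkeeping] -/
theorem n15At_and_not_live_of_isEmpty (c : NE2Carriers) [IsEmpty c.I] : N15At c ∧ ¬ Live c :=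
  ⟨n15At_of_isEmpty c, fun h => by
    obtain ⟨i, -⟩ := h.cofinal 0 0
    exact isEmptyElim i⟩

/-- **(J2) BOUNDED SIZE PARAMETER ⇒ THE OPERATOR LAYER FOR ARBITRARY KERNELS**: if every instance has `gf.M < M₅` for some `M₅ > 0`, then `NE2PlusOperator c35 pi Kop`
holds whatever `c35` and `Kop` are (witness `M₅`, all other constants `1`; the clause «`M₅ ≤ gf.M → …`» never fires). [bookkeeping] -/
theorem ne2PlusOperator_of_gf_M_lt {I : Type} (c35 : ℝ) (pi : I → PairedInstance) (Kop : ∀ i, B9.KernelFamily (pi i).gc (pi i).Bf) {M₅ : ℝ}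
    (hM₅ : 0 < M₅) (h : ∀ i, (pi i).gf.M < M₅) : NE2PlusOperator c35 pi Kop :=
  ⟨M₅, 1, 1, 1, 1, hM₅, one_pos, one_pos, one_pos, one_pos, fun i hi => absurd hi (not_le.mpr (h i))⟩

/-- **(J2) BOUNDED SIZE PARAMETER ⇒ THE SITE-KERNEL LAYER FOR ARBITRARY KERNELS** (every `d`, `p`, `c35`). [bookkeeping] -/
theorem ne2PlusSite_of_gf_M_lt {I : Type} (d : ℕ) (p c35 : ℝ) (pi : I → PairedInstance) (Ksite : ∀ i, B9.SiteKernel (pi i).gc (pi i).Bf) {M₅ : ℝ}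
    (hM₅ : 0 < M₅) (h : ∀ i, (pi i).gf.M < M₅) : NE2PlusSite d p c35 pi Ksite :=
  ⟨M₅, 1, 1, 1, 1, hM₅, one_pos, one_pos, one_pos, one_pos, fun i hi => absurd hi (not_le.mpr (h i))⟩

/-- **(J2) A BOUNDED-`M` FAMILY FAILS THE GUARD.** [bookkeeping] -/
theorem not_live_of_gf_M_lt (c : NE2Carriers) {M₅ : ℝ} (h : ∀ i, (c.pi i).gf.M < M₅) : ¬ Live c := fun hl => by
  obtain ⟨i, hi, -⟩ := hl.cofinal M₅ 0
  exact (not_le.mpr (h i)) hi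

section TwoGrid

variable {d L : ℕ} [NeZero L]

/-- The [B9] size parameter of the -a lane's two-grid realised instances is the INERT `1` (`B6UnitTorusCarrier.unitTorusGeo … M := 1`; `rfl`). [bookkeeping] -/
theorem tgInstance_gf_M (hL : Odd L ∧ 1 < L) (i : TGIndex) : (tgInstance d hL i).gf.M = 1 := rfl

/-- **(J2) AT `tgInstance`, LOCATED IN KERNEL (dag-ref-B READ-335's probe in guard form): on EVERY family `tgInstance d hL ∘ f` the operator layer holds FOR ARBITRARY
KERNELS and every `c35` (`M₅ := 2`).**  The -a lane's operator-layer theorems on these carriers prove the (3.42)-shape bound at EVERY index with `M₅ := 1`; the by-name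
`NE2PlusOperator` corollary does not certify that (bounded-`M` class). [bookkeeping] -/
theorem ne2PlusOperator_tgInstance_comp (hL : Odd L ∧ 1 < L) {I : Type} (f : I → TGIndex) (c35 : ℝ)
    (Kop : ∀ i, B9.KernelFamily (tgInstance d hL (f i)).gc (tgInstance d hL (f i)).Bf) : NE2PlusOperator c35 (fun i => tgInstance d hL (f i)) Kop :=
  ne2PlusOperator_of_gf_M_lt c35 _ Kop two_pos fun i => by
    rw [tgInstance_gf_M]
    norm_num

/-- **(J2) AT `tgInstance`: the site-kernel layer likewise, for arbitrary kernels, `d′`, `p`, `c35`.** [bookkeeping] -/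
theorem ne2PlusSite_tgInstance_comp (hL : Odd L ∧ 1 < L) {I : Type} (f : I → TGIndex) (d' : ℕ) (p c35 : ℝ)
    (Ksite : ∀ i, B9.SiteKernel (tgInstance d hL (f i)).gc (tgInstance d hL (f i)).Bf) : NE2PlusSite d' p c35 (fun i => tgInstance d hL (f i)) Ksite :=
  ne2PlusSite_of_gf_M_lt d' p c35 _ Ksite two_pos fun i => by
    rw [tgInstance_gf_M]
    norm_num

/-- **(J2) AT `tgInstance`: NO carriers on a family `tgInstance d hL ∘ f` pass the guard** (whatever the kernels, region and distance). [bookkeeping] -/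
theorem not_live_tgInstance_comp (hL : Odd L ∧ 1 < L) {I : Type} (f : I → TGIndex) (c35 p : ℝ)
    (Kop : ∀ i, B9.KernelFamily (tgInstance d hL (f i)).gc (tgInstance d hL (f i)).Bf)
    (Ksite Kunit : ∀ i, B9.SiteKernel (tgInstance d hL (f i)).gc (tgInstance d hL (f i)).Bf)
    (inΛ : ∀ i, (tgInstance d hL (f i)).gc.Site → Prop) (unitDist : ∀ i, (tgInstance d hL (f i)).gc.Site → (tgInstance d hL (f i)).gc.Site → ℝ) :
    ¬ Live ⟨I, c35, p, fun i => tgInstance d hL (f i), Kop, Ksite, Kunit, inΛ, unitDist⟩ :=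
  not_live_of_gf_M_lt _ (M₅ := 2) fun i => by
    show (tgInstance d hL (f i)).gf.M < 2
    rw [tgInstance_gf_M]
    norm_num

end TwoGrid

section KeyedDoors

variable {N : ℕ} [NeZero N]
  (rr : (F : T4Family) → (θ : Stage13HParams F N) → θ.Provisos₁₃CoPH F N → (ℕ → ℝ) → List (ULoop F) → RateCarriers N)

/-- **(J1) KEYED — R3's negative control**: as soon as ONE guarded admissible Stage-13 tuple exists (K0⁷'s content), a reading whose paired family is EMPTY at every
tuple (dag-n18-e evidence #5's `keyedRates_junk` shape) FAILS `KeyedLive`. [bookkeeping] -/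
theorem not_keyedLive_of_isEmpty
    (hex : ∃ (F : T4Family) (θ : Stage13HParams F N) (_ : θ.Provisos₁₃CoPH F N), (θ.ZhUnity F N ∧ θ.SlotsNondegenerate₁₃ F N) ∧ θ.Admissible F N)
    (h : ∀ (F : T4Family) (θ : Stage13HParams F N) (hP : θ.Provisos₁₃CoPH F N) (g₀ : ℕ → ℝ) (os : List (ULoop F)), IsEmpty (rr F θ hP g₀ os).ne2.I) :
    ¬ KeyedLive rr := fun hk => by
  obtain ⟨F, θ, hP, hU, hθ⟩ := hex
  haveI := h F θ hP (fun _ => 0) []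
  exact (n15At_and_not_live_of_isEmpty (rr F θ hP (fun _ => 0) []).ne2).2 (hk F θ hP hU hθ (fun _ => 0) [])

/-- **(J2) KEYED**: under the same existence, a reading whose paired families have UNIFORMLY BOUNDED size parameter `gf.M` FAILS `KeyedLive` — although by
`ne2PlusOperator_of_gf_M_lt` ∕ `ne2PlusSite_of_gf_M_lt` its operator and site layers hold everywhere for arbitrary kernels. [bookkeeping] -/
theorem not_keyedLive_of_gf_M_lt
    (hex : ∃ (F : T4Family) (θ : Stage13HParams F N) (_ : θ.Provisos₁₃CoPH F N), (θ.ZhUnity F N ∧ θ.SlotsNondegenerate₁₃ F N) ∧ θ.Admissible F N)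
    {M₅ : ℝ} (h : ∀ (F : T4Family) (θ : Stage13HParams F N) (hP : θ.Provisos₁₃CoPH F N) (g₀ : ℕ → ℝ) (os : List (ULoop F)) (i : (rr F θ hP g₀ os).ne2.I),
      ((rr F θ hP g₀ os).ne2.pi i).gf.M < M₅) :
    ¬ KeyedLive rr := fun hk => by
  obtain ⟨F, θ, hP, hU, hθ⟩ := hex
  exact not_live_of_gf_M_lt _ (h F θ hP (fun _ => 0) []) (hk F θ hP hU hθ (fun _ => 0) [])

/-- **HONESTY — located vacuity**: if NO guarded admissible Stage-13 tuple exists (the negation of K0⁷'s content at `N`), EVERY reading is keyed-live with no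
witness at all; the keyed guard is worth exactly K0. [bookkeeping] -/
theorem keyedLive_of_no_tuple
    (hno : ∀ (F : T4Family) (θ : Stage13HParams F N), θ.Provisos₁₃CoPH F N → (θ.ZhUnity F N ∧ θ.SlotsNondegenerate₁₃ F N) → ¬ θ.Admissible F N) :
    KeyedLive rr := fun F θ hP hU hθ _ _ => absurd hθ (hno F θ hP hU)

end KeyedDoors

/-- **(J3) ZERO KERNELS CARRY ALL THREE LAYERS ON EVERY SIGN-SANE FAMILY — the door NO carrier guard closes** (honesty): if the lengths, sup norms, spacing and
block factor are non-negative and every entry ∕ kernel vanishes, `N15At c` holds with all constants `1` (`θ = ½`).  Live or not: `N15At` does not see WHICH kernels are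
pinned; that is the pin BY NAME (NODE 00's [B9] operator layer), not a guard. [bookkeeping] -/
theorem n15At_of_kernels_zero (c : NE2Carriers) (hη : ∀ i, 0 ≤ (c.pi i).gc.eta) (hL : ∀ i, 0 ≤ (c.pi i).gc.L)
    (hlen : ∀ (i : c.I) (y : (c.pi i).gc.Site), 0 ≤ (c.pi i).gc.len y) (hsup : ∀ (i : c.I) (lam : (c.pi i).gc.Loc), 0 ≤ (c.pi i).gc.supNorm lam)
    (hop : ∀ (i : c.I) (n : Fin 4) (U : (c.pi i).Bf.Cfg) (lam : (c.pi i).gc.Loc) (y : (c.pi i).gc.Site), (c.Kop i).e n U lam y = 0)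
    (hsite : ∀ (i : c.I) (U : (c.pi i).Bf.Cfg) (y y' : (c.pi i).gc.Site), (c.Ksite i).ker U y y' = 0)
    (hunit : ∀ (i : c.I) (U : (c.pi i).Bf.Cfg) (y y' : (c.pi i).gc.Site), (c.Kunit i).ker U y y' = 0) : N15At c := by
  refine ⟨⟨1, 1, 1, 1, 1, one_pos, one_pos, one_pos, one_pos, one_pos, fun i _ α₀ _ _ U _ n lam y y' _ => ?_⟩,
    ⟨1, 1, 1, 1, 1, one_pos, one_pos, one_pos, one_pos, one_pos, fun i _ α₀ _ _ U _ y y' => ?_⟩,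
    ⟨1, 1, 1, 1 / 2, one_pos, one_pos, one_pos, by norm_num, by norm_num, fun i α₀ _ _ U _ _ y y' _ _ => ?_⟩⟩
  · rw [hop]
    have hpref : 0 ≤ B9.pref4 ((c.pi i).gc.len y) n := by
      have h0 := hlen i y
      fin_cases n <;> simp [B9.pref4] <;> nlinarith [h0]
    have hrf : 0 ≤ max (rateFactor (c.pi i).gc 1 y) (rateFactor (c.pi i).gc 1 y') :=
      le_max_of_le_left (rateFactor_nonneg (hη i) (hL i) 1 y)
    exact mul_nonneg (mul_nonneg (mul_nonneg (mul_nonneg zero_le_one hpref) (Real.exp_nonneg _)) hrf) (hsup i lam)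
  · rw [hsite, abs_zero]
    have hrf : 0 ≤ max (rateFactor (c.pi i).gc 1 y) (rateFactor (c.pi i).gc 1 y') :=
      le_max_of_le_left (rateFactor_nonneg (hη i) (hL i) 1 y)
    exact mul_nonneg (mul_nonneg (mul_nonneg (mul_nonneg zero_le_one (Real.rpow_nonneg (hlen i y) _)) (Real.rpow_nonneg (hlen i y') _))
      (Real.exp_nonneg _)) hrf
  · rw [hunit, abs_zero]
    positivity

/-! ## §3 What the guard makes the node's clauses SAY about the pinned kernels -/

section Content

variable {c : NE2Carriers}

/-- **UNDER THE GUARD THE OPERATOR LAYER BITES**: `N15At c ∧ Live c ⇒` uniform `(B₀, δ₀, γ) > 0` such that BEYOND EVERY THRESHOLD `(M₅, k₀)` some instance carries the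
(3.42)-shape η-rate inequality `EtaRateIneq342 (c.Kop i) B₀ δ₀ γ` AT THE TRIVIAL CONFIGURATION — for `c`'s OWN operator kernels, at unboundedly many scales (a genuine
rate statement; the admissible `α₀ := a₀ ∕ gf.M`). [bookkeeping] -/
theorem etaRateIneq342_one_cofinal_of_live (h : N15At c) (hl : Live c) :
    ∃ B₀ δ₀ γ : ℝ, 0 < B₀ ∧ 0 < δ₀ ∧ 0 < γ ∧ ∀ (M₅ : ℝ) (k₀ : ℕ), ∃ i : c.I,
      M₅ ≤ (c.pi i).gf.M ∧ k₀ ≤ (c.pi i).gc.k ∧ EtaRateIneq342 (c.Kop i) B₀ δ₀ γ (c.pi i).Bf.one := by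
  obtain ⟨M₅, δ₀, a₀, B₀, γ, hM₅, hδ₀, ha₀, hB₀, hγ, H⟩ := h.1
  refine ⟨B₀, δ₀, γ, hB₀, hδ₀, hγ, fun M₅' k₀ => ?_⟩
  obtain ⟨i, hi, hk⟩ := hl.cofinal (max M₅ M₅') k₀
  have hMi : M₅ ≤ (c.pi i).gf.M := (le_max_left _ _).trans hi
  have hMpos : 0 < (c.pi i).gf.M := hM₅.trans_le hMi
  have hα : 0 < a₀ / (c.pi i).gf.M := div_pos ha₀ hMpos
  have hMa : (c.pi i).gf.M * (a₀ / (c.pi i).gf.M) ≤ a₀ := by rw [← mul_div_assoc, mul_div_cancel_left₀ _ hMpos.ne']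
  exact ⟨i, (le_max_right _ _).trans hi, hk, H i hMi _ hα hMa _ (hl.reg_one i _ hα).1⟩

/-- **UNDER THE GUARD THE SITE-KERNEL LAYER BITES** (`d = 4`, exponent `c.p`): uniform `(C, δ, γ) > 0` and, beyond every threshold, an instance carrying
`EtaRateIneqSite 4 c.p (c.Ksite i) C δ γ` at the trivial configuration. [bookkeeping] -/
theorem etaRateIneqSite_one_cofinal_of_live (h : N15At c) (hl : Live c) :
    ∃ C δ γ : ℝ, 0 < C ∧ 0 < δ ∧ 0 < γ ∧ ∀ (M₅ : ℝ) (k₀ : ℕ), ∃ i : c.I,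
      M₅ ≤ (c.pi i).gf.M ∧ k₀ ≤ (c.pi i).gc.k ∧ EtaRateIneqSite 4 c.p (c.Ksite i) C δ γ (c.pi i).Bf.one := by
  obtain ⟨M₅, δ, a₀, C, γ, hM₅, hδ, ha₀, hC, hγ, H⟩ := h.2.1
  refine ⟨C, δ, γ, hC, hδ, hγ, fun M₅' k₀ => ?_⟩
  obtain ⟨i, hi, hk⟩ := hl.cofinal (max M₅ M₅') k₀
  have hMi : M₅ ≤ (c.pi i).gf.M := (le_max_left _ _).trans hi
  have hMpos : 0 < (c.pi i).gf.M := hM₅.trans_le hMi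
  have hα : 0 < a₀ / (c.pi i).gf.M := div_pos ha₀ hMpos
  have hMa : (c.pi i).gf.M * (a₀ / (c.pi i).gf.M) ≤ a₀ := by rw [← mul_div_assoc, mul_div_cancel_left₀ _ hMpos.ne']
  exact ⟨i, (le_max_right _ _).trans hi, hk, H i hMi _ hα hMa _ (hl.reg_one i _ hα).1⟩

/-- **UNDER THE GUARD THE UNIT-LATTICE LAYER IS A RATE**: uniform `(B₀, δ₀) > 0`, `θ ∈ (0, 1)` and, beyond every threshold `(M₅, k₀)`, an instance with `k ≥ k₀` scales
carrying `EtaRateIneqUnit (c.Kunit i) (c.inΛ i) (c.unitDist i) B₀ δ₀ θ k` at the trivial configuration on a met region — `θ^k → 0` along the family. [bookkeeping] -/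
theorem etaRateIneqUnit_one_cofinal_of_live (h : N15At c) (hl : Live c) :
    ∃ B₀ δ₀ θ : ℝ, 0 < B₀ ∧ 0 < δ₀ ∧ 0 < θ ∧ θ < 1 ∧ ∀ (M₅ : ℝ) (k₀ : ℕ), ∃ i : c.I,
      M₅ ≤ (c.pi i).gf.M ∧ k₀ ≤ (c.pi i).gc.k ∧ (∃ y : (c.pi i).gc.Site, c.inΛ i y) ∧
        EtaRateIneqUnit (c.Kunit i) (c.inΛ i) (c.unitDist i) B₀ δ₀ θ (c.pi i).gc.k (c.pi i).Bf.one := by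
  obtain ⟨δ₀, a₀, B₀, θ, hδ₀, ha₀, hB₀, hθ0, hθ1, H⟩ := h.2.2
  refine ⟨B₀, δ₀, θ, hB₀, hδ₀, hθ0, hθ1, fun M₅ k₀ => ?_⟩
  obtain ⟨i, hi, hk⟩ := hl.cofinal (max 1 M₅) k₀
  have hMpos : 0 < (c.pi i).gf.M := one_pos.trans_le ((le_max_left _ _).trans hi)
  have hα : 0 < a₀ / (c.pi i).gf.M := div_pos ha₀ hMpos
  have hMa : (c.pi i).gf.M * (a₀ / (c.pi i).gf.M) ≤ a₀ := by rw [← mul_div_assoc, mul_div_cancel_left₀ _ hMpos.ne']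
  exact ⟨i, (le_max_right _ _).trans hi, hk, hl.inΛ_nonempty i, H i _ hα hMa _ (hl.reg_one i _ hα).1 (hl.reg_one i _ hα).2⟩

/-- **UNDER (G4) THE OPERATOR LAYER GIVES NE2⁰ BY NAME** (`T4EtaRate.ne2Zero_of_ne2Plus`; still subject to (J2) unless (G1–G3) hold — read with the theorem above). [bookkeeping] -/
theorem ne2ZeroOperator_of_live (h : N15At c) (hl : Live c) : NE2ZeroOperator c.pi c.Kop :=
  ne2Zero_of_ne2Plus (fun i α₀ hα => (hl.reg_one i α₀ hα).1) h.1

end Content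

/-! ## §4 Tree families against the guard: the LG-vector knit family PASSES and is an A6 inhabitant of «guard ∧ `N15At`» -/

section Knit

/-- **THE KNIT FAMILY PASSES THE GUARD** (every `L ≥ 1`, labels, letters): on `NE2NodeTorus.KnitIndex 3 L` the cube size `i.M ≥ 1` and the scale count `i.k` are FREE
index data (`T4EtaRateSiteTorus.TorusIndex` v1.2), so `(M₅, k₀) ↦` the torus with all periods `L`, `k := k₀`, `M := max 1 M₅`; one-point backgrounds are regular
(`pt9Bg`); `inAll` is met at the site `0`. [bookkeeping] -/
theorem live_knitCarriers (L : ℕ) [NeZero L] (μ ν a b μ' lam α β : Fin 4) (c35 p : ℝ) :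
    Live ⟨KnitIndex 3 L, c35, p, knitInstance 3 L, knitOp166 L μ ν a b, knitSite163 L μ' lam, covOpKernels L α β, inAll L, rhoDist L⟩ := by
  refine ⟨fun M₅ k₀ => ?_, fun _ _ _ => ⟨trivial, trivial⟩, fun i => ?_⟩
  · refine ⟨⟨{ k := k₀, N := fun _ => L, M := max 1 M₅, one_le := le_max_left _ _ }, fun _ => dvd_rfl⟩, ?_, ?_⟩
    · exact le_max_right 1 M₅
    · exact le_rfl
  · haveI := i.1.neZero
    exact ⟨fun _ => 0, trivial⟩

/-- ★ **A6 INHABITANT OF «GUARD ∧ `N15At`», HYPOTHESIS-FREE** (`L ≥ 2`, `μ ≠ ν`): the -a lane's LG-vector knit carriers (Δ_k (1.66) ∕ H_k (1.63) ∕ C^{(k)} (2.156) at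
`U ≡ 1` on the four-dimensional unit tori) are LIVE and carry `N15At` (`N15Knit.N15_with_zero_layers_dim4` BY NAME) — the positive control for R3: a v2 stub 1 conjoined
with `KeyedLive` is satisfiable at the N15 slot by a contentful (model-level) family.  MODEL level: NOT Bałaban's multiscale `G(U)`. [bookkeeping] -/
theorem live_and_n15At_knitCarriers (L : ℕ) [NeZero L] (hL : 2 ≤ L) {μ ν : Fin 4} (hμν : μ ≠ ν) (a b μ' lam α β : Fin 4) (c35 p : ℝ) :
    Live ⟨KnitIndex 3 L, c35, p, knitInstance 3 L, knitOp166 L μ ν a b, knitSite163 L μ' lam, covOpKernels L α β, inAll L, rhoDist L⟩ ∧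
      N15At ⟨KnitIndex 3 L, c35, p, knitInstance 3 L, knitOp166 L μ ν a b, knitSite163 L μ' lam, covOpKernels L α β, inAll L, rhoDist L⟩ :=
  ⟨live_knitCarriers L μ ν a b μ' lam α β c35 p, (N15_with_zero_layers_dim4 L hL hμν a b μ' lam α β c35 p).1⟩

variable {N : ℕ} [NeZero N]

/-- ★ **SOME STAGE-13 READING PASSES `KeyedLive` AT THE BUNDLE OF RECORD AND CARRIES `N15At` THERE, FOR EVERY RUN-LENGTH SELECTOR** (R3's positive control at the N15
slot): the reading whose NE2 objects at every tuple and run length are the knit objects on `KnitIndex 3 2` (the other rate objects = RR-1's sanity inhabitant, the dressed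
tower empty — «don't-care» fillers of NO content, displayed in the proof). [bookkeeping] -/
theorem exists_reading_keyedLive_n15At {μ ν : Fin 4} (hμν : μ ≠ ν) (a b μ' lam α β : Fin 4) (c35 p : ℝ) :
    ∃ 𝔯 : RateReading₁₃CoPH N, ∀ ksel : (F : T4Family) → (θ : Stage13HParams F N) → θ.Provisos₁₃CoPH F N → (ℕ → ℝ) → List (ULoop F) → ℕ,
      KeyedLive (fun F θ hP g₀ os => rateCarriersOfRecord₁₃CoPH 𝔯 F θ hP g₀ os (ksel F θ hP g₀ os)) ∧
      ∀ (F : T4Family) (θ : Stage13HParams F N) (hP : θ.Provisos₁₃CoPH F N) (g₀ : ℕ → ℝ) (os : List (ULoop F)),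
        N15At (rateCarriersOfRecord₁₃CoPH 𝔯 F θ hP g₀ os (ksel F θ hP g₀ os)).ne2 := by
  obtain ⟨r₀⟩ := nonempty_rateObjects₁₁ (N := N)
  let o : NE2Objects₁₁ := ⟨KnitIndex 3 2, c35, p, knitInstance 3 2, knitOp166 2 μ ν a b, knitSite163 2 μ' lam, covOpKernels 2 α β, inAll 2, rhoDist 2⟩
  let 𝔯 : RateReading₁₃CoPH N :=
    ⟨fun _ _ _ _ _ => ⟨r₀.u3, r₀.ne3, fun _ => o⟩, fun _ _ _ _ _ => (⟨Empty, ⟨fun q => q.elim, fun q => q.elim, fun q => q.elim⟩, 0⟩ : NE1pCarriers)⟩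
  have key := live_and_n15At_knitCarriers 2 le_rfl hμν a b μ' lam α β c35 p
  exact ⟨𝔯, fun ksel => ⟨fun F θ hP _ _ g₀ os => key.1, fun F θ hP g₀ os => key.2⟩⟩

end Knit

end Summit.QuantumFields.YangMills.BalabanUVNodes.N15.PairedFamilyGuard

end
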